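import Literature.NumberTheory.Automorphic.ArchInnerFormCartanAtlas     -- ★ p849656 (T-ATLAS) PART 2b (LH3-p03 (g2)): `gprimeTorus`, `gprimeBlock`, `formRe`, `formSign` (+ PART 2a `lineOf`, `gprimeCptGL`, re-indexing kit)
import Mathlib.Data.Matrix.PEquiv                                       -- permutation matrices `Equiv.toPEquiv.toMatrix`
import HarnessLib

/-!
# The compact Weyl reflections of SAME-SIGN lines ARE REALISED in `G′_∞`: an involutive conjugating element for `gprimeTorus α S′ (update c w (c w ∘ swap i j))`
# ((SWAP-CONJ) — LH3 direct road, the compact-swap half of `ArchHcWeyl` for the genuine family `orbFamG`; Rogawski 1990 §3.6; Knapp 1986 V §3; Shelstad 1979 §4)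

Topic `NumberTheory/Automorphic`; namespace `Literature.NumberTheory.Automorphic.UnitaryGroup`.  THEOREMS ONLY (no definition, no instance, no notation, no axiom, no named
fact, no `sorry`); kernel lane `--kind proof --supports stmt-HodgeConjecture-24833`.  Cell `pub/hodgecm-mathlib`, crux H413 (`stmt-HodgeConjecture-24833`), F0∕P3c line LH3,
DIRECT ROAD of `stub_N9`; seat LH4-p01 (g2), sibling of ★ p849857 `ArchInnerFormCartanAtlasWeyl` ((NEGX-CONJ), the split reflection).  Asked for by LH3-p02 (g2) 2026-09-02T06:32:53Z ∕
06:34:43Z («the COMPACT-SWAP half of `archHcWeyl_orbFamG` waits on a realised-swap conjugacy `gprimeTorus (hcSwapAt w i j c) = n · gprimeTorus c · n⁻¹` with `n ∈ G′_∞`»;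
★ `ArchHCSpaceG.hcSwapAt w i j c := Function.update c w (c w ∘ Equiv.swap i j)` — stated here with that body literally, so no analysis import is needed).  Count-neutral.

THE MATHEMATICS.  At a COMPACT place `w ∉ S′` the chart point of `G′_w = U(diag a)(ℂ)` (`a = formRe L α w`, slot order `τ = lineOf (formSign L α w)`) is the unit diagonal
`diag(ℓ ↦ e^{i c(τ⁻¹ ℓ)})` (★ `gprimeCptGL`).  The transposition of two slots `i, j` whose lines carry the SAME sign (`sgn a_{τ i} = sgn a_{τ j}`) is a reflection in a COMPACT
root, hence realised in `G′_w` [Shelstad 1979 §4 p. 23]: in slot coordinates (form `b = a ∘ τ`) the scaled transposition `M = diag(d) · P_σ`, `σ = swap i j`,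
`d_k = √(b_{σ k} ∕ b_k)` (`= 1` off `{i, j}`) satisfies
  `ᵗM̄ · diag(b) · M = diag(b)` (⟸ `d_k² b_k = b_{σ k}`, i.e. the ratio is POSITIVE — the same-sign hypothesis),   `M · M = 1` (⟸ `d_k d_{σ k} = 1`),   `M · diag(z) = diag(z ∘ σ) · M`
(a monomial matrix permutes the entries of a diagonal matrix), and re-indexing by `τ` (★ PART 2a `conjTranspose_submatrix_mul_diagonal_mul_submatrix`) carries the three identities to
the place.  The conjugator in `G′_∞` is `M_τ` at `w` and `1` elsewhere (★ `archPiEquivCM`, `Pi.mulSingle`).  §1 is written for ANY involution `σ` of the slots and any index type.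
* §1 monomial involutions `diag(d) · P_σ` (generic `n`): `diagonal_mul_toPEquiv_apply`, `diagonal_mul_toPEquiv_mul_apply`, `mul_diagonal_mul_toPEquiv_apply`,
  `diagonal_mul_toPEquiv_mul_diagonal` (`M · diag z = diag (z ∘ σ) · M`, no hypothesis), `diagonal_mul_toPEquiv_mul_self` (`M · M = diag(k ↦ d_k d_{σ k})` for `σ² = 1`),
  `conjTranspose_diagonal_mul_toPEquiv_mul` (`ᵗM̄ · diag b · M = diag b` for real `d` with `d_k² b_k = b_{σ k}`);
* §2 the scaling `d_k = √(a_{τ σ k} ∕ a_{τ k})`: `sqrt_ratio_sq_mul`, `sqrt_ratio_mul_sqrt_ratio`, and the place matrix `M_τ`: `swapMatrix_mul_self`, `conjTranspose_swapMatrix_mul`,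
  `swapMatrix_mul_coe_gprimeCptGL`;
* §3 `G′_∞`: **`exists_involutive_conj_gprimeTorus_perm`** (any slot involution `σ` with positive ratios) and **`exists_involutive_conj_gprimeTorus_swap`**
  (`σ = swap i j`, same-sign slots: `∃ g, g · g = 1 ∧ ∀ c, g · gprimeTorus α S′ c · g⁻¹ = gprimeTorus α S′ (update c w (c w ∘ swap i j))` for `w ∉ S′`).
All statements are generic in the `DecidableEq` instance on the complex places (binder), as ★ p849857.  HONEST LABEL: HC_CM is proved only modulo the 7 printed citations
(2 remaining: hLiu418 = `stmt-HodgeConjecture-24832`, h413 = `stmt-HodgeConjecture-24833`) until rung 0 closes; chart bookkeeping (+0∕+0).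

## References
* [Rogawski1990] J. D. Rogawski, *Automorphic Representations of Unitary Groups in Three Variables*, Ann. of Math. Stud. 123 (1990), §3.6 p. 31 (Cartan subgroups of `U(2,1)`,
  `U(3)` and their Weyl groups), §4.3 (4.3.1) p. 43.
* [Knapp1986] A. W. Knapp, *Representation Theory of Semisimple Groups* (1986), Ch. V §3 (compact roots: the reflection is realised in `K`).
* [Shelstad1979] D. Shelstad, *Characters and inner forms of a quasi-split group over ℝ*, Compositio Math. 39 (1979), §4 p. 23 (realised vs. imaginary-noncompact Weyl reflections).
-/

set_option autoImplicit false

noncomputable section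

open NumberField NumberField.InfinitePlace Matrix Complex
open scoped MatrixGroups Matrix ComplexConjugate Real

namespace Literature.NumberTheory.Automorphic.UnitaryGroup

/-! ## §1 Monomial involutions `diag(d) · P_σ` -/

section Monomial

variable {n : Type*} [Fintype n] [DecidableEq n]

/-- Entries of the monomial matrix: `(diag d · P_σ)_{k l} = d_k [l = σ k]`. [cite: Knapp1986, Ch. V §3] -/
theorem diagonal_mul_toPEquiv_apply (d : n → ℂ) (σ : Equiv.Perm n) (k l : n) :
    (Matrix.diagonal d * (σ.toPEquiv.toMatrix : Matrix n n ℂ)) k l = if l = σ k then d k else 0 := by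
  rw [Matrix.diagonal_mul, PEquiv.toMatrix_toPEquiv_apply, Pi.single_apply, mul_ite, mul_one, mul_zero]

/-- Row action: `(diag d · P_σ · X)_{k l} = d_k X_{σ k, l}`. [cite: Knapp1986, Ch. V §3] -/
theorem diagonal_mul_toPEquiv_mul_apply (d : n → ℂ) (σ : Equiv.Perm n) (X : Matrix n n ℂ) (k l : n) :
    (Matrix.diagonal d * (σ.toPEquiv.toMatrix : Matrix n n ℂ) * X) k l = d k * X (σ k) l := by
  rw [Matrix.mul_assoc, PEquiv.toMatrix_toPEquiv_mul, Matrix.diagonal_mul, Matrix.submatrix_apply, id]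

/-- Column action: `(X · diag d · P_σ)_{k l} = X_{k, σ⁻¹ l} d_{σ⁻¹ l}`. [cite: Knapp1986, Ch. V §3] -/
theorem mul_diagonal_mul_toPEquiv_apply (d : n → ℂ) (σ : Equiv.Perm n) (X : Matrix n n ℂ) (k l : n) :
    (X * (Matrix.diagonal d * (σ.toPEquiv.toMatrix : Matrix n n ℂ))) k l = X k (σ.symm l) * d (σ.symm l) := by
  rw [← Matrix.mul_assoc, PEquiv.mul_toMatrix_toPEquiv, Matrix.submatrix_apply, id, Matrix.mul_diagonal]

/-- **A monomial matrix permutes diagonal entries**: `diag d · P_σ · diag z = diag (z ∘ σ) · diag d · P_σ` (no hypothesis). [cite: Knapp1986, Ch. V §3] -/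
theorem diagonal_mul_toPEquiv_mul_diagonal (d : n → ℂ) (σ : Equiv.Perm n) (z : n → ℂ) :
    Matrix.diagonal d * (σ.toPEquiv.toMatrix : Matrix n n ℂ) * Matrix.diagonal z = Matrix.diagonal (z ∘ σ) * (Matrix.diagonal d * (σ.toPEquiv.toMatrix : Matrix n n ℂ)) := by
  ext k l
  rw [diagonal_mul_toPEquiv_mul_apply, Matrix.diagonal_mul, diagonal_mul_toPEquiv_apply, Matrix.diagonal_apply, Function.comp_apply]
  by_cases h : l = σ k
  · subst h
    rw [if_pos rfl, if_pos rfl, mul_comm]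
  · rw [if_neg (fun e => h e.symm), if_neg h, mul_zero, mul_zero]

/-- **`(diag d · P_σ)² = diag(k ↦ d_k d_{σ k})` for an involution `σ`**. [cite: Knapp1986, Ch. V §3] -/
theorem diagonal_mul_toPEquiv_mul_self (d : n → ℂ) {σ : Equiv.Perm n} (hσ : ∀ k, σ (σ k) = k) :
    Matrix.diagonal d * (σ.toPEquiv.toMatrix : Matrix n n ℂ) * (Matrix.diagonal d * (σ.toPEquiv.toMatrix : Matrix n n ℂ)) = Matrix.diagonal fun k => d k * d (σ k) := by
  ext k l
  rw [diagonal_mul_toPEquiv_mul_apply, diagonal_mul_toPEquiv_apply, hσ k, Matrix.diagonal_apply]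
  by_cases h : k = l
  · subst h
    rw [if_pos rfl, if_pos rfl]
  · rw [if_neg (fun e => h e.symm), if_neg h, mul_zero]

/-- **Unitarity for a real diagonal form**: if `d` is real with `d_k² b_k = b_{σ k}` then `ᵗ(diag d · P_σ)‾ · diag b · (diag d · P_σ) = diag b`. [cite: Knapp1986, Ch. V §3]
[cite: Rogawski1990, §1.9 p. 8] -/
theorem conjTranspose_diagonal_mul_toPEquiv_mul (d b : n → ℝ) (σ : Equiv.Perm n) (hdb : ∀ k, d k ^ 2 * b k = b (σ k)) :
    (Matrix.diagonal (fun k => (d k : ℂ)) * (σ.toPEquiv.toMatrix : Matrix n n ℂ))ᴴ * Matrix.diagonal (fun k => (b k : ℂ)) *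
        (Matrix.diagonal (fun k => (d k : ℂ)) * (σ.toPEquiv.toMatrix : Matrix n n ℂ)) = Matrix.diagonal (fun k => (b k : ℂ)) := by
  ext l l'
  rw [mul_diagonal_mul_toPEquiv_apply, Matrix.mul_diagonal, Matrix.conjTranspose_apply, diagonal_mul_toPEquiv_apply, Equiv.apply_symm_apply, Matrix.diagonal_apply]
  by_cases h : l = l'
  · subst h
    rw [if_pos rfl, if_pos rfl, Complex.star_def, Complex.conj_ofReal]
    have hk := hdb (σ.symm l)
    rw [Equiv.apply_symm_apply] at hk
    rw [← hk]
    push_cast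
    ring
  · rw [if_neg h, if_neg h, star_zero, zero_mul, zero_mul]

end Monomial

/-! ## §2 The scaling `d_k = √(a_{τ σ k} ∕ a_{τ k})` and the place matrix `M_τ = (diag d · P_σ).submatrix τ⁻¹ τ⁻¹` -/

section Place

variable (τ : Fin 3 ≃ Fin 3) (a : Fin 3 → ℝ) {σ : Equiv.Perm (Fin 3)}

/-- `d_k² · a_{τ k} = a_{τ σ k}` for the scaling `d_k = √(a_{τ σ k} ∕ a_{τ k})` when the ratio is positive. [cite: Knapp1986, Ch. V §3] -/
theorem sqrt_ratio_sq_mul (hrat : ∀ k, 0 < a (τ (σ k)) / a (τ k)) (k : Fin 3) :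
    Real.sqrt (a (τ (σ k)) / a (τ k)) ^ 2 * a (τ k) = a (τ (σ k)) := by
  have hk : a (τ k) ≠ 0 := by
    intro h
    have := hrat k
    rw [h, div_zero] at this
    exact lt_irrefl _ this
  rw [Real.sq_sqrt (le_of_lt (hrat k)), div_mul_cancel₀ _ hk]

/-- `d_k · d_{σ k} = 1` for an involution `σ` (the two ratios are inverse to each other). [cite: Knapp1986, Ch. V §3] -/
theorem sqrt_ratio_mul_sqrt_ratio (hσ : ∀ k, σ (σ k) = k) (hrat : ∀ k, 0 < a (τ (σ k)) / a (τ k)) (k : Fin 3) :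
    Real.sqrt (a (τ (σ k)) / a (τ k)) * Real.sqrt (a (τ (σ (σ k))) / a (τ (σ k))) = 1 := by
  rw [hσ k, ← Real.sqrt_mul (le_of_lt (hrat k))]
  have hk : a (τ k) ≠ 0 := by
    intro h
    have := hrat k
    rw [h, div_zero] at this
    exact lt_irrefl _ this
  have hk' : a (τ (σ k)) ≠ 0 := by
    intro h
    have := hrat k
    rw [h, zero_div] at this
    exact lt_irrefl _ this
  rw [div_mul_div_comm, mul_comm (a (τ (σ k))) (a (τ k)), div_self (mul_ne_zero hk hk'), Real.sqrt_one]

/-- **`M_τ · M_τ = 1`** for an involution `σ` with positive ratios. [cite: Knapp1986, Ch. V §3] -/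
theorem swapMatrix_mul_self (hσ : ∀ k, σ (σ k) = k) (hrat : ∀ k, 0 < a (τ (σ k)) / a (τ k)) :
    (Matrix.diagonal (fun k => (Real.sqrt (a (τ (σ k)) / a (τ k)) : ℂ)) * (σ.toPEquiv.toMatrix : Matrix (Fin 3) (Fin 3) ℂ)).submatrix τ.symm τ.symm *
        (Matrix.diagonal (fun k => (Real.sqrt (a (τ (σ k)) / a (τ k)) : ℂ)) * (σ.toPEquiv.toMatrix : Matrix (Fin 3) (Fin 3) ℂ)).submatrix τ.symm τ.symm = 1 := by
  rw [Matrix.submatrix_mul_equiv, diagonal_mul_toPEquiv_mul_self _ hσ]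
  have h1 : (fun k => (Real.sqrt (a (τ (σ k)) / a (τ k)) : ℂ) * (Real.sqrt (a (τ (σ (σ k))) / a (τ (σ k))) : ℂ)) = fun _ => (1 : ℂ) := by
    funext k
    exact_mod_cast sqrt_ratio_mul_sqrt_ratio τ a hσ hrat k
  rw [h1, Matrix.diagonal_one, Matrix.submatrix_one_equiv]

/-- **`ᵗM̄_τ · diag(a) · M_τ = diag(a)`**: the place matrix preserves the real diagonal form `diag(a)` when the ratios are positive (PART 2a re-indexing). [cite: Rogawski1990, §1.9 p. 8]
[cite: Knapp1986, Ch. V §3] -/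
theorem conjTranspose_swapMatrix_mul (hrat : ∀ k, 0 < a (τ (σ k)) / a (τ k)) :
    ((Matrix.diagonal (fun k => (Real.sqrt (a (τ (σ k)) / a (τ k)) : ℂ)) * (σ.toPEquiv.toMatrix : Matrix (Fin 3) (Fin 3) ℂ)).submatrix τ.symm τ.symm)ᴴ * Matrix.diagonal (fun i => (a i : ℂ)) *
        (Matrix.diagonal (fun k => (Real.sqrt (a (τ (σ k)) / a (τ k)) : ℂ)) * (σ.toPEquiv.toMatrix : Matrix (Fin 3) (Fin 3) ℂ)).submatrix τ.symm τ.symm = Matrix.diagonal (fun i => (a i : ℂ)) := by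
  refine conjTranspose_submatrix_mul_diagonal_mul_submatrix _ _ τ ?_
  have e : ((fun i => (a i : ℂ)) ∘ τ) = fun k => ((a (τ k) : ℝ) : ℂ) := rfl
  rw [e]
  exact conjTranspose_diagonal_mul_toPEquiv_mul _ _ σ (sqrt_ratio_sq_mul τ a hrat)

/-- **`M_τ · gprimeCptGL τ c = gprimeCptGL τ (c ∘ σ) · M_τ`**: the place matrix permutes the angles of the compact chart (no hypothesis). [cite: Rogawski1990, §3.6 p. 31]
[cite: Knapp1986, Ch. V §3] -/
theorem swapMatrix_mul_coe_gprimeCptGL (σ : Equiv.Perm (Fin 3)) (d : Fin 3 → ℂ) (c : Fin 3 → ℝ) :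
    (Matrix.diagonal d * (σ.toPEquiv.toMatrix : Matrix (Fin 3) (Fin 3) ℂ)).submatrix τ.symm τ.symm * ((gprimeCptGL τ c : GL (Fin 3) ℂ) : Matrix (Fin 3) (Fin 3) ℂ) =
      ((gprimeCptGL τ (c ∘ σ) : GL (Fin 3) ℂ) : Matrix (Fin 3) (Fin 3) ℂ) * (Matrix.diagonal d * (σ.toPEquiv.toMatrix : Matrix (Fin 3) (Fin 3) ℂ)).submatrix τ.symm τ.symm := by
  have hz : ((gprimeCptGL τ c : GL (Fin 3) ℂ) : Matrix (Fin 3) (Fin 3) ℂ) =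
      (Matrix.diagonal fun k => Complex.exp ((c k : ℂ) * I)).submatrix τ.symm τ.symm := by
    rw [coe_gprimeCptGL, Matrix.submatrix_diagonal_equiv]
    rfl
  have hz' : ((gprimeCptGL τ (c ∘ σ) : GL (Fin 3) ℂ) : Matrix (Fin 3) (Fin 3) ℂ) =
      (Matrix.diagonal ((fun k => Complex.exp ((c k : ℂ) * I)) ∘ σ)).submatrix τ.symm τ.symm := by
    rw [coe_gprimeCptGL, Matrix.submatrix_diagonal_equiv]
    rfl
  rw [hz, hz', Matrix.submatrix_mul_equiv, Matrix.submatrix_mul_equiv, diagonal_mul_toPEquiv_mul_diagonal]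

end Place

/-! ## §3 `G′_∞`: the realised compact reflections -/

section GPrime

variable (L : Type) [Field L] [NumberField L] [IsCMField L] (α : Fin 3 → L) [DecidableEq {w : InfinitePlace L // IsComplex w}]

/-- **REALISED SLOT INVOLUTIONS (general form).**  At a place `w ∉ S′` where the form is real, for every involution `σ` of the slots whose ratios `a_{τ σ k} ∕ a_{τ k}` are all
positive (`τ = lineOf (formSign L α w)`, `a = formRe L α w`) there is `g ∈ G′_∞` with `g · g = 1` and `g · gprimeTorus α S′ c · g⁻¹ = gprimeTorus α S′ (update c w (c w ∘ σ))` for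
EVERY `c`: the place matrix `M_τ` at `w` (§2: in `G′_w` by `conjTranspose_swapMatrix_mul`, involutive by `swapMatrix_mul_self`, permuting the compact chart's angles by
`swapMatrix_mul_coe_gprimeCptGL`) and `1` at every `v ≠ w`. [cite: Shelstad1979, §4 p. 23] [cite: Rogawski1990, §3.6 p. 31] [cite: Knapp1986, Ch. V §3] -/
theorem exists_involutive_conj_gprimeTorus_perm {w : {w : InfinitePlace L // IsComplex w}} (hreal : ∀ k, (w.1.embedding (α k)).im = 0)
    {S' : Finset {w : InfinitePlace L // IsComplex w}} (hw : w ∉ S') {σ : Equiv.Perm (Fin 3)} (hσ : ∀ k, σ (σ k) = k)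
    (hrat : ∀ k, 0 < formRe L α w (lineOf (formSign L α w) (σ k)) / formRe L α w (lineOf (formSign L α w) k)) :
    ∃ g : ↥(arch (↥(maximalRealSubfield L)) L (IsCMField.complexConj L) 3 (Matrix.diagonal α)),
      g * g = 1 ∧ ∀ c : {w : InfinitePlace L // IsComplex w} → Fin 3 → ℝ,
        g * gprimeTorus L α S' c * g⁻¹ = gprimeTorus L α S' (Function.update c w (c w ∘ σ)) := by
  -- the place matrix, its involutivity, the `GL₃(ℂ)` element it defines, and its membership in `G′_w`
  set τ : Fin 3 ≃ Fin 3 := lineOf (formSign L α w) with hτ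
  set a : Fin 3 → ℝ := formRe L α w with ha
  set N : Matrix (Fin 3) (Fin 3) ℂ :=
    (Matrix.diagonal (fun k => (Real.sqrt (a (τ (σ k)) / a (τ k)) : ℂ)) * (σ.toPEquiv.toMatrix : Matrix (Fin 3) (Fin 3) ℂ)).submatrix τ.symm τ.symm with hN
  have hNN : N * N = 1 := swapMatrix_mul_self τ a hσ hrat
  set u : GL (Fin 3) ℂ := ⟨N, N, hNN, hNN⟩ with hu
  have hmem : u ∈ archLocal L 3 (Matrix.diagonal α) w := by
    rw [mem_archLocal_iff_conjTranspose, diagonal_map_embedding_eq_of_real hreal]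
    exact conjTranspose_swapMatrix_mul τ a hrat
  have huu : (⟨u, hmem⟩ : ↥(archLocal L 3 (Matrix.diagonal α) w)) * ⟨u, hmem⟩ = 1 := by
    apply Subtype.ext
    rw [Subgroup.coe_mul, Subgroup.coe_one]
    exact Units.ext hNN
  refine ⟨(archPiEquivCM 3 L (Matrix.diagonal α)).symm (Pi.mulSingle w ⟨u, hmem⟩), ?_, fun c => ?_⟩
  · rw [← map_mul, ← Pi.mulSingle_mul, huu, Pi.mulSingle_one, map_one]
  · rw [mul_inv_eq_iff_eq_mul]
    unfold gprimeTorus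
    rw [← map_mul, ← map_mul]
    congr 1
    funext v
    rw [Pi.mul_apply, Pi.mul_apply]
    apply Subtype.ext
    rw [Subgroup.coe_mul, Subgroup.coe_mul]
    by_cases hv : v = w
    · subst hv
      rw [Pi.mulSingle_eq_same, coe_gprimeBlock_of_not_mem L α _ hw, coe_gprimeBlock_of_not_mem L α _ hw, Function.update_self]
      refine Matrix.GeneralLinearGroup.ext fun k l => ?_
      rw [Units.val_mul, Units.val_mul]
      show (N * ((gprimeCptGL τ (c v) : GL (Fin 3) ℂ) : Matrix (Fin 3) (Fin 3) ℂ)) k l =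
        (((gprimeCptGL τ (c v ∘ σ) : GL (Fin 3) ℂ) : Matrix (Fin 3) (Fin 3) ℂ) * N) k l
      rw [swapMatrix_mul_coe_gprimeCptGL]
    · rw [Pi.mulSingle_eq_of_ne hv, Subgroup.coe_one, one_mul, mul_one]
      unfold gprimeBlock
      simp only [Function.update_of_ne hv]

/-- **THE COMPACT REFLECTIONS OF SAME-SIGN LINES ARE REALISED IN `G′_∞`** (the compact-swap half of `ArchHcWeyl` for the genuine family): at a place `w ∉ S′` of the house frame
(`α_k ≠ 0`, `σ_w α_k` real) and two slots `i, j` whose lines carry the same sign, there is `g ∈ G′_∞` with `g · g = 1` and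
`g · gprimeTorus α S′ c · g⁻¹ = gprimeTorus α S′ (update c w (c w ∘ swap i j))` (`= gprimeTorus α S′ (hcSwapAt w i j c)` of ★ `ArchHCSpaceG`) for EVERY `c` — so every orbital
integral on `G′_∞` takes the same value at the two chart points, and `Ad(g)` is an involution of the chart torus. [cite: Shelstad1979, §4 p. 23] [cite: Rogawski1990, §3.6 p. 31;
§4.3 (4.3.1) p. 43] [cite: Knapp1986, Ch. V §3] -/
theorem exists_involutive_conj_gprimeTorus_swap (hα : ∀ k, α k ≠ 0) {w : {w : InfinitePlace L // IsComplex w}} (hreal : ∀ k, (w.1.embedding (α k)).im = 0)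
    {S' : Finset {w : InfinitePlace L // IsComplex w}} (hw : w ∉ S') (i j : Fin 3)
    (hs : formSign L α w (lineOf (formSign L α w) i) = formSign L α w (lineOf (formSign L α w) j)) :
    ∃ g : ↥(arch (↥(maximalRealSubfield L)) L (IsCMField.complexConj L) 3 (Matrix.diagonal α)),
      g * g = 1 ∧ ∀ c : {w : InfinitePlace L // IsComplex w} → Fin 3 → ℝ,
        g * gprimeTorus L α S' c * g⁻¹ = gprimeTorus L α S' (Function.update c w (c w ∘ Equiv.swap i j)) := by
  refine exists_involutive_conj_gprimeTorus_perm L α hreal hw (fun k => Equiv.swap_apply_self i j k) fun k => ?_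
  -- the ratios `a_{τ (swap i j k)} ∕ a_{τ k}` are positive: `1` off `{i, j}`, same-sign quotients on `{i, j}`
  have hne : ∀ m, formRe L α w (lineOf (formSign L α w) m) ≠ 0 := fun m => formRe_ne_zero hα hreal _
  have key : ∀ m m' : Fin 3, formSign L α w (lineOf (formSign L α w) m) = formSign L α w (lineOf (formSign L α w) m') →
      0 < formRe L α w (lineOf (formSign L α w) m') / formRe L α w (lineOf (formSign L α w) m) := by
    intro m m' h
    simp only [formSign] at h
    rcases lt_or_gt_of_ne (hne m) with hm | hm
    · have hm' : formRe L α w (lineOf (formSign L α w) m') < 0 := by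
        have h1 : SignType.sign (formRe L α w (lineOf (formSign L α w) m')) = -1 := by rw [← h, sign_eq_neg_one_iff]; exact hm
        exact sign_eq_neg_one_iff.1 h1
      exact div_pos_of_neg_of_neg hm' hm
    · have hm' : 0 < formRe L α w (lineOf (formSign L α w) m') := by
        have h1 : SignType.sign (formRe L α w (lineOf (formSign L α w) m')) = 1 := by rw [← h, sign_eq_one_iff]; exact hm
        exact sign_eq_one_iff.1 h1
      exact div_pos hm' hm
  by_cases hki : k = i
  · subst hki
    rw [Equiv.swap_apply_left]
    exact key _ _ hs
  · by_cases hkj : k = j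
    · subst hkj
      rw [Equiv.swap_apply_right]
      exact key _ _ hs.symm
    · rw [Equiv.swap_apply_of_ne_of_ne hki hkj]
      exact div_pos_iff.2 (Or.imp (fun h => ⟨h, h⟩) (fun h => ⟨h, h⟩) (lt_or_gt_of_ne (hne k)).symm)

end GPrime

end Literature.NumberTheory.Automorphic.UnitaryGroup

end
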